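import Summits.NavierStokesRegularity.NavierStokesRegularity.Theorems.OddMorawetzLocal.Negative.OddMorawetzLocalRefutationData5
import Summits.NavierStokesRegularity.NavierStokesRegularity.Theorems.OddMorawetzLocal.Negative.OddMorawetzLocalRefutationDefsV
import HarnessLib

/-!
# Crux `OddMorawetzLocal` (stmt-NavierStokesRegularity-1376) — kernel certificates, weight 5 (part A2b)

The finite computations of the weight-5 half of the refutation, each a closed Boolean evaluated by the kernel
(`decide +kernel`) on the vocabulary of `OddMorawetzLocalJetAlgebra` / `…RefutationDefs{,Fast,IV,V}` and the literal
data of `…RefutationData5` (197 orbit representatives `reps5`, 50 isotropic descriptors `isoDesc5`, three certificate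
blocks `blocks5` of sizes 53/45/49, the independence columns `kcols5` and inverse `cinv5`, prime 8191).
Part A2: `cert5_e1_*` — the orbit-sum identities `e1Check 5 reps5 lo n` (step E1: a `B₃`-fixed coefficient vector lies in
the span of the 197 normalised orbit sums) for the basis monomials of the listed ranges, in chunks of 100 (kernel memory).
No analysis; lands `--supports` the crux item; consumed by the weight-5 assembly of the refutation.
-/

set_option linter.dupNamespace false

namespace Summit.NavierStokesRegularity.NavierStokesRegularity.Theorems.OddMorawetz

/-- Orbit-sum identities for the weight-5 basis monomials `2400 … 2499`. -/
theorem cert5_e1_24 : e1Check 5 reps5 2400 100 = true := by decide +kernel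

/-- Orbit-sum identities for the weight-5 basis monomials `2500 … 2599`. -/
theorem cert5_e1_25 : e1Check 5 reps5 2500 100 = true := by decide +kernel

/-- Orbit-sum identities for the weight-5 basis monomials `2600 … 2699`. -/
theorem cert5_e1_26 : e1Check 5 reps5 2600 100 = true := by decide +kernel

/-- Orbit-sum identities for the weight-5 basis monomials `2700 … 2799`. -/
theorem cert5_e1_27 : e1Check 5 reps5 2700 100 = true := by decide +kernel

/-- Orbit-sum identities for the weight-5 basis monomials `2800 … 2899`. -/
theorem cert5_e1_28 : e1Check 5 reps5 2800 100 = true := by decide +kernel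

/-- Orbit-sum identities for the weight-5 basis monomials `2900 … 2999`. -/
theorem cert5_e1_29 : e1Check 5 reps5 2900 100 = true := by decide +kernel

/-- Orbit-sum identities for the weight-5 basis monomials `3000 … 3099`. -/
theorem cert5_e1_30 : e1Check 5 reps5 3000 100 = true := by decide +kernel

/-- Orbit-sum identities for the weight-5 basis monomials `3100 … 3199`. -/
theorem cert5_e1_31 : e1Check 5 reps5 3100 100 = true := by decide +kernel

end Summit.NavierStokesRegularity.NavierStokesRegularity.Theorems.OddMorawetz
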